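import Mathlib
import Literature.Probability.LatticeModels.TemperleyLiebBaxterization
import Literature.Probability.Percolation.DiagonalColumnPatterns
import Literature.Probability.Percolation.DiagonalStripTransferInhomogeneous
import Literature.Probability.Percolation.DiagonalStripTLAction
import Literature.Probability.Percolation.DiagonalStripLumping
import Literature.Probability.Percolation.DiagonalStripQKZPropagation
import Literature.Probability.Percolation.DiagonalStripGenericRapidities
import Literature.Probability.Percolation.DiagonalStripGenericSwap
import HarnessLib

/-!
# The exchange equations over the rapidity field propagate through `t(w; z⃗)`

Topic `Literature/Probability/Percolation`. Ikhlef–Ponsaing (J. Stat. Phys. 149 (2012),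
arXiv:1202.5476) §3.4 in the generic setting (`DiagonalStripGenericRapidities.lean`,
`DiagonalStripGenericSwap.lean`): for a vector `ψ : ColPattern m → Frac K₀[X]` supported on valid
patterns, the `i`-th exchange equation reads
`[q z_{i+1}/z_i] ψ(Q) - [z_i/z_{i+1}] Σ_{e_i Q₀ ≡ Q} ψ(Q₀) = γ σ_i(ψ(Q))` (`σ_i` the swap automorphism,
`γ = [q z_i/z_{i+1}]` in IP12); **`genSwap_exchange_propagate_odd/_even`**: if `ψ` satisfies it then
so does `t(w; z⃗)ψ` (no genericity hypotheses: only `q² + q + 1 = 0` in `K₀`), and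
`sum_ipTransferMatrixW_apply_generic` (component sums preserved). This is the transfer-matrix half
of "the ground state of `t` is the polynomial solution of the boundary qKZ system"; the other half
is a uniqueness theorem for that system (de Gier–Pyatov), not here.

## References

* Y. Ikhlef, A. K. Ponsaing, J. Stat. Phys. 149 (2012) 10–36, arXiv:1202.5476, §3.4.
  [IkhlefPonsaing2012]
-/

namespace Literature.Probability.Percolation

open Literature.Probability.LatticeModels

variable {m : ℕ}

/-! ### The exchange equations over the rapidity field: propagation through `t` -/

section PropagateGeneric

variable {K₀ : Type*} [Field K₀]

open Literature.Probability.LatticeModels.TemperleyLieb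

/-- **Propagation of the `i`-th exchange equation through `t(w; z⃗)` over the rapidity field, odd
`i = 2j+1`.** If `ψ : ColPattern m → Frac K₀[X]` (supported on valid patterns) satisfies
`[q z_{i+1}/z_i] ψ(Q) - [z_i/z_{i+1}] Σ_{e_i Q₀ ≡ Q} ψ(Q₀) = γ σ_i(ψ(Q))` for all `Q`, then so does
`Φ = t(w; z⃗) ψ`. [cite: IkhlefPonsaing2012, §3.4] -/
theorem genSwap_exchange_propagate_odd {q : K₀} (hq : q ^ 2 + q + 1 = 0) (j j1 : Fin (m + 1))
    (hj1 : (j1 : ℕ) = j + 1) {ψ : ColPattern m → RapidityField K₀} {γ : RapidityField K₀}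
    (hV : ∀ Q, ψ Q ≠ 0 → IsValid 0 Q)
    (hψ : ∀ Q, qbr (genC K₀ q * genZ K₀ (2 * j + 2) / genZ K₀ (2 * j + 1)) * ψ Q -
      qbr (genZ K₀ (2 * j + 1) / genZ K₀ (2 * j + 2)) *
        ∑ Q₀ ∈ Finset.univ.filter (fun Q₀ => lump (cpJoin j j1 Q₀) = Q), ψ Q₀ =
      γ * genSwap K₀ (2 * j + 1) (ψ Q)) (Q'' : ColPattern m) :
    qbr (genC K₀ q * genZ K₀ (2 * j + 2) / genZ K₀ (2 * j + 1)) *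
          (∑ Q, ipTransferMatrixW m (genC K₀ q) (genW K₀) (genZ K₀) Q Q'' * ψ Q) -
        qbr (genZ K₀ (2 * j + 1) / genZ K₀ (2 * j + 2)) *
          ∑ Q' ∈ Finset.univ.filter (fun Q' => lump (cpJoin j j1 Q') = Q''),
            ∑ Q, ipTransferMatrixW m (genC K₀ q) (genW K₀) (genZ K₀) Q Q' * ψ Q =
      γ * genSwap K₀ (2 * j + 1) (∑ Q, ipTransferMatrixW m (genC K₀ q) (genW K₀) (genZ K₀) Q Q'' * ψ Q) := by
  have hq0 := ne_zero_of_quad hq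
  have h := ipTransferMatrixW_exchange_propagate_odd (genC_quad hq) genW_ne_zero (genZ K₀) j j1 hj1
    (genZ_ne_zero _) (genZ_ne_zero _) (qbr_genW_div_genZ_ne_zero hq0 (by omega))
    (qbr_genW_div_genZ_ne_zero hq0 (by omega)) (qbr_genW_mul_genZ_ne_zero hq0 _) (qbr_genW_mul_genZ_ne_zero hq0 _)
    (ψ' := fun Q => genSwap K₀ (2 * j + 1) (ψ Q)) hV hψ Q''
  rw [h, map_sum]
  congr 1
  refine Finset.sum_congr rfl fun Q _ => ?_
  rw [map_mul, genSwap_ipTransferMatrixW (by omega)]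

/-- The same at an even level `i = 2b`. [cite: IkhlefPonsaing2012, §3.4] -/
theorem genSwap_exchange_propagate_even {q : K₀} (hq : q ^ 2 + q + 1 = 0) (b0 b : Fin (m + 1))
    (hb0 : (b : ℕ) = b0 + 1) {ψ : ColPattern m → RapidityField K₀} {γ : RapidityField K₀}
    (hV : ∀ Q, ψ Q ≠ 0 → IsValid 0 Q)
    (hψ : ∀ Q, qbr (genC K₀ q * genZ K₀ (2 * b + 1) / genZ K₀ (2 * b)) * ψ Q -
      qbr (genZ K₀ (2 * b) / genZ K₀ (2 * b + 1)) *
        ∑ Q₀ ∈ Finset.univ.filter (fun Q₀ => lump (cpIsolate b Q₀) = Q), ψ Q₀ =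
      γ * genSwap K₀ (2 * b) (ψ Q)) (Q'' : ColPattern m) :
    qbr (genC K₀ q * genZ K₀ (2 * b + 1) / genZ K₀ (2 * b)) *
          (∑ Q, ipTransferMatrixW m (genC K₀ q) (genW K₀) (genZ K₀) Q Q'' * ψ Q) -
        qbr (genZ K₀ (2 * b) / genZ K₀ (2 * b + 1)) *
          ∑ Q' ∈ Finset.univ.filter (fun Q' => lump (cpIsolate b Q') = Q''),
            ∑ Q, ipTransferMatrixW m (genC K₀ q) (genW K₀) (genZ K₀) Q Q' * ψ Q =
      γ * genSwap K₀ (2 * b) (∑ Q, ipTransferMatrixW m (genC K₀ q) (genW K₀) (genZ K₀) Q Q'' * ψ Q) := by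
  have hq0 := ne_zero_of_quad hq
  have h := ipTransferMatrixW_exchange_propagate_even (genC_quad hq) genW_ne_zero (genZ K₀) b0 b hb0
    (genZ_ne_zero _) (genZ_ne_zero _) (qbr_genW_div_genZ_ne_zero hq0 (by omega))
    (qbr_genW_div_genZ_ne_zero hq0 (by omega)) (qbr_genW_mul_genZ_ne_zero hq0 _) (qbr_genW_mul_genZ_ne_zero hq0 _)
    (ψ' := fun Q => genSwap K₀ (2 * b) (ψ Q)) hV hψ Q''
  rw [h, map_sum]
  congr 1
  refine Finset.sum_congr rfl fun Q _ => ?_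
  rw [map_mul, genSwap_ipTransferMatrixW (by omega)]

/-- **`t(w; z⃗)` preserves the component sum** (generic setting): `Σ_{Q''} (tψ)(Q'') = Σ_Q ψ(Q)` — with
the propagation of the exchange equations this is what forces the eigenvalue `1` once `tψ ∝ ψ`.
[cite: IkhlefPonsaing2012, §3.4] -/
theorem sum_ipTransferMatrixW_apply_generic (q : K₀) (ψ : ColPattern m → RapidityField K₀) :
    ∑ Q'', ∑ Q, ipTransferMatrixW m (genC K₀ q) (genW K₀) (genZ K₀) Q Q'' * ψ Q = ∑ Q, ψ Q :=
  sum_ipTransferMatrixW_apply _ _ _ ψ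

end PropagateGeneric

end Literature.Probability.Percolation
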